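/-
Copyright (c) 2026 the pub-hodgecm-mathlib formalisation cell (harness21).  Prover seat hodgecm-mathlib-K2Liu-p01 (g0): Track B «K2-LIT», #184♮ = hLiu418,
ASSEMBLY of socket #13 `sig_K2LiuDoublingUnfold` MODULO the single-orbit lemma H4 (U5 «DOUBLING ZETA», LEAD F0P6-plan (g10) DEAL 2026-09-03T21:14:18Z).
-/
import Summits.HodgeConjecture.HodgeConjecture.Theorems.K2LiuDoublingUnfoldEngine
import Summits.HodgeConjecture.HodgeConjecture.Theorems.K2LiuDoublingUnfoldTwist
import Summits.HodgeConjecture.HodgeConjecture.Theorems.K2LiuDoublingUnfoldOrbit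
import Literature.NumberTheory.Automorphic.AdelicUnitaryGroupDatum
import Literature.NumberTheory.Automorphic.UnitaryGroupOfFormAdelicTopology
import Literature.NumberTheory.Automorphic.LevelOrbitPushforward
import HarnessLib

/-!
# Crux `HLiu418`, Track B road `K2_Liu`, unit U5: socket #13 `sig_K2LiuDoublingUnfold` ASSEMBLED MODULO THE SINGLE-ORBIT LEMMA (H4)

Cell `hodgecm-mathlib`, crux item hLiu418 = `stmt-HodgeConjecture-24832`, route of record `HCCMUnconditional`; squad K2 ∕ K2Liu, LEAD F0P6-plan
(g10), prover K2Liu-p01 (g0) (REPORT-FIRST plan for #13, K2/STATUS 21:19:45Z; RULING 21:19:59Z).  THEOREMS ONLY (no `def`, no instance, no notation,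
no `sorry`, default heartbeats); imports the seat's ★ helpers H3 `K2LiuDoublingUnfoldEngine` (p854905), H6 `K2LiuDoublingUnfoldTwist` (p854966), H7
`K2LiuDoublingUnfoldOrbit` (p855008) (which bring H1∕H2 p854919, H5 p854938, #10a p854746, #10b p854756), ★ `AdelicUnitaryGroupDatum`
(`adelicGroupData_isDiscreteRational`), ★ `UnitaryGroupOfFormAdelicTopology` (`U(J)(𝔸)` locally compact ∕ second countable ∕ T₂), ★
`LevelOrbitPushforward` (`isMulRightInvariant_of_compactSpace_quotient`) + HarnessLib; lane `--supports stmt-HodgeConjecture-24832 --as helper`.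

WHAT IS PROVED.  `doublingUnfold_of_mainOrbit` — **the statement of socket #13 `sig_K2LiuDoublingUnfold` (U5 ED. 3∕4 bytes, binders VERBATIM) with ONE
extra hypothesis inserted after `_hanis`**, the single-orbit lemma (plan item H4, Liu 2021 (B.5) at `a = 0` for anisotropic `V`):
`hMain : ∀ h ∈ H(L⁺), ∃ a₀ ∈ U(diag dV)(L⁺), h · ι(a₀, 1)⁻¹ ∈ P_Δ`.  So #13 closes by one `exact doublingUnfold_of_mainOrbit … (mainOrbit …) …`
the minute H4 lands (`Theorems/K2LiuDoublingUnfoldMainOrbit.lean`, next).  HONEST: this file is a CONDITIONAL assembly; it retires nothing.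

PROOF (Liu 2021 Lem. B.11; PSR's basic identity).  `G := U(H)(𝔸)`, `Γ := U(H)(L⁺)` (discrete ★, `A_G = 1`), `dh` a Haar measure on `G`
(two-sided: `[G]` is compact, ★ `isMulRightInvariant_of_compactSpace_quotient`), `μ ≠ 0` (open-positive).  Feed the ★ H3 engine
`exists_haar_unfold_orbitSum_prod_integral` (⇒ `ν = a • dh`) with `c k := f(ι(ιA k, 1))` (continuous: `f`, ★ `continuous_iotaLeft`, `ιA` = ★ similitude
iso), `F₁ := φ₁`, `F₂ := φ₂^χ = T · φ₂` (continuous by ★ H6 `continuous_twist`), `K(q₁,q₂) := Σ'_γ c(q₂.out γ q₁.out⁻¹)`, `Kabs` its norm-sum (★ H2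
`tsum_orbit_out_eq` gives the engine's all-representatives law).  The two socket hypotheses transfer along the orbit bijection ★ H7: (summability)
`Summable_q ‖f(q.out · ι(ιA x₁⁻¹, ιA x₂⁻¹))‖ ⟹ Summable_γ ‖c(x₂ γ x₁⁻¹)‖` (`summable_eisenstein_iff` + `apply_iotaLeft_mul_iotaV`: the summands differ by the
unit `χ_s(ι(ιA x₂⁻¹, ιA x₂⁻¹))`); (integrability) `‖E_{‖f‖}(x)‖ ‖φ₁‖ ‖φ₂‖ = Kabs(x) ‖φ₁‖ ‖T φ₂‖` pointwise (`eisensteinSeriesDelta_eq_tsum` for `‖f‖`,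
same representative `out x₂` on both sides).  The engine returns the integrability of `h ↦ c(h)⟨π(h)φ₁, φ₂^χ⟩` (= ★ `DoublingZetaConverges`) and
`∫_{μ⊗μ} K φ₁ conj(φ₂^χ) = ∫ c ⟨π(·)φ₁, φ₂^χ⟩ dν` (= ★ `doublingZeta`), while `E_f(x) φ₁ conj φ₂ = K(x) φ₁ conj(φ₂^χ)` pointwise
(`eisensteinSeriesDelta_eq_tsum` for `f`, `conj χ_s · χ_s`-bookkeeping) identifies the left side with ★ `doublingPairing`.

HONEST LABEL.  Count-neutral; `HC_CM` is proved only modulo the 7 printed citations (hLiu418 = 24832, h413 = 24833) until rung 0 closes.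

## References
* [Liu2021] Y. Liu, *Fourier–Jacobi cycles and arithmetic relative trace formula*, Camb. J. Math. 9 (2021): App. B §B.3 (B.5)–(B.7) p. 101, Lem. B.11 p. 102.
* [GelbartPiatetskishapiroRallis1987] S. Gelbart, I. Piatetski-Shapiro, S. Rallis, LNM 1254 (1987), Part A §2 (the basic identity).
* [HarrisKudlaSweet1996] M. Harris, S. S. Kudla, W. J. Sweet, J. AMS 9 (1996): §1 (1.2)–(1.5).
-/

noncomputable section

open scoped Matrix ENNReal ComplexConjugate
open NumberField IsDedekindDomain MeasureTheory

namespace Summit.HodgeConjecture.HodgeConjecture.Cruxes.HLiu418.K2LiuDoublingUnfoldOfMainOrbit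

open Literature.NumberTheory.Automorphic Literature.NumberTheory.GaloisRepresentations
open Literature.NumberTheory.GelbartRogawski1991 Literature.NumberTheory.GelbartRogawski1991.GRConstruction
open Literature.NumberTheory.K2Lit.SiegelDoubled
open Literature.NumberTheory.Automorphic.UnitaryGroup (adelicGroupData adelicVal)
open Literature.AlgebraicGeometry.ShimuraVarieties (hermForm)
open Summit.HodgeConjecture.HodgeConjecture.Cruxes.HLiu418.K2LiuDoublingUnfoldEngine
open Summit.HodgeConjecture.HodgeConjecture.Cruxes.HLiu418.K2LiuDoublingUnfoldOrbitPrelims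
open Summit.HodgeConjecture.HodgeConjecture.Cruxes.HLiu418.K2LiuDoublingUnfoldBridge
open Summit.HodgeConjecture.HodgeConjecture.Cruxes.HLiu418.K2LiuDoublingUnfoldTwist
open Summit.HodgeConjecture.HodgeConjecture.Cruxes.HLiu418.K2LiuDoublingUnfoldOrbit
open Summit.HodgeConjecture.HodgeConjecture.Cruxes.HLiu418.K2LiuSiegelEisensteinDoubledLeftInvariant (apply_siegelDeltaRat_mul)

/-- **Socket #13 `sig_K2LiuDoublingUnfold` MODULO H4**: the socket's statement VERBATIM with the single-orbit lemma inserted as the hypothesis `hMain`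
after `_hanis` (see the module docstring for the proof).  [cite: Liu2021, Lem. B.11 p. 102 (a = 0)] [cite: GelbartPiatetskishapiroRallis1987, Part A §2]
[cite: HarrisKudlaSweet1996, §1 (1.2)–(1.5)] -/
theorem doublingUnfold_of_mainOrbit :
    ∀ (L : Type) [Field L] [NumberField L] [IsCMField L] {N n : ℕ} (e : Fin N × Fin 1 ≃ Fin n)
      (H : Matrix (Fin N) (Fin N) L)
      (dV : Fin N → L) (hdV : ∀ i, IsCMField.complexConj L (dV i) = dV i)
      (dW : Fin 1 → L) (hdW : ∀ i, IsCMField.complexConj L (dW i) = dW i)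
      (_hdV0 : ∀ i, dV i ≠ 0) (_hdW0 : ∀ i, dW i ≠ 0)
      (t : L) (_ht : t ≠ 0) (g : GL (Fin N) L)
      (_hg : formCongr ((IsCMField.complexConj L : L ≃ₐ[↥(maximalRealSubfield L)] L) : L →+* L) g (t • H) = Matrix.diagonal dV)
      (_hanis : ∀ x : Fin N → L, hermForm (cmConjRingHom L) H x x = 0 → x = 0)
      (_hMain : ∀ h : ratH L e dV hdV dW hdW, ∃ a₀ : UnitaryGroup.rational (Fp L) L (IsCMField.complexConj L) N (Matrix.diagonal dV),
        IsSiegelDelta L e dV hdV dW hdW ((h : HA L e dV hdV dW hdW) *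
          (iotaLeft L e dV hdV dW hdW (UnitaryGroup.toAdelic (Fp L) L (IsCMField.complexConj L) N (Matrix.diagonal dV) a₀))⁻¹))
      (μ : Measure (adelicGroupData (↥(maximalRealSubfield L)) L (IsCMField.complexConj L) N H).automorphicQuotient)
      [(adelicGroupData (↥(maximalRealSubfield L)) L (IsCMField.complexConj L) N H).IsAutomorphicMeasure μ]
      (ιA : (adelicGroupData (↥(maximalRealSubfield L)) L (IsCMField.complexConj L) N H).Adelic →*
        ↥(UnitaryGroup.adelic (↥(maximalRealSubfield L)) L (IsCMField.complexConj L) N (Matrix.diagonal dV))),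
      (∀ k, ((ιA k : ↥(UnitaryGroup.adelic (↥(maximalRealSubfield L)) L (IsCMField.complexConj L) N (Matrix.diagonal dV))) :
            GL (Fin N) (AdeleRing (𝓞 L) L)) =
          (toAdeleGL L g)⁻¹ * adelicVal (↥(maximalRealSubfield L)) L (IsCMField.complexConj L) N H k * toAdeleGL L g) →
      ∀ [CompactSpace (adelicGroupData (↥(maximalRealSubfield L)) L (IsCMField.complexConj L) N H).automorphicQuotient]
        [MeasurableSpace (adelicGroupData (↥(maximalRealSubfield L)) L (IsCMField.complexConj L) N H).Adelic]
        [BorelSpace (adelicGroupData (↥(maximalRealSubfield L)) L (IsCMField.complexConj L) N H).Adelic],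
      ∃ ν : Measure (adelicGroupData (↥(maximalRealSubfield L)) L (IsCMField.complexConj L) N H).Adelic, ν.IsHaarMeasure ∧
        ∀ (χ : HeckeCharacter L) (s : ℂ) (f : HA L e dV hdV dW hdW → ℂ),
          IsSiegelDeltaSection L e dV hdV dW hdW χ s f → Continuous f →
          (∀ h : HA L e dV hdV dW hdW, Summable fun q : SiegelDeltaQuot L e dV hdV dW hdW =>
              ‖f (((Quotient.out q : ratH L e dV hdV dW hdW) : HA L e dV hdV dW hdW) * h)‖) →
          ∀ (φ₁ φ₂ : (adelicGroupData (↥(maximalRealSubfield L)) L (IsCMField.complexConj L) N H).automorphicQuotient → ℂ),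
            Continuous φ₁ → Continuous φ₂ →
            Integrable (fun x : (adelicGroupData (↥(maximalRealSubfield L)) L (IsCMField.complexConj L) N H).automorphicQuotient ×
                  (adelicGroupData (↥(maximalRealSubfield L)) L (IsCMField.complexConj L) N H).automorphicQuotient =>
                ‖toQuotFun₂ (adelicGroupData (↥(maximalRealSubfield L)) L (IsCMField.complexConj L) N H)
                    (eisensteinPullback L e dV hdV dW hdW
                      (adelicGroupData (↥(maximalRealSubfield L)) L (IsCMField.complexConj L) N H) ιA
                      (fun h => ((‖f h‖ : ℝ) : ℂ))) x‖ * ‖φ₁ x.1‖ * ‖φ₂ x.2‖) (μ.prod μ) →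
            DoublingZetaConverges L e dV hdV dW hdW (adelicGroupData (↥(maximalRealSubfield L)) L (IsCMField.complexConj L) N H)
                ν μ ιA f φ₁
                (fun x => starRingEnd ℂ (siegelDeltaCharacter L e dV hdV dW hdW χ s
                    (iotaV L e dV hdV dW hdW
                      (ιA ((Quotient.out (x : (adelicGroupData (↥(maximalRealSubfield L)) L (IsCMField.complexConj L) N H).Adelic ⧸
                          (adelicGroupData (↥(maximalRealSubfield L)) L (IsCMField.complexConj L) N H).quotientSubgroup)) :
                          (adelicGroupData (↥(maximalRealSubfield L)) L (IsCMField.complexConj L) N H).Adelic)⁻¹,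
                       ιA ((Quotient.out (x : (adelicGroupData (↥(maximalRealSubfield L)) L (IsCMField.complexConj L) N H).Adelic ⧸
                          (adelicGroupData (↥(maximalRealSubfield L)) L (IsCMField.complexConj L) N H).quotientSubgroup)) :
                          (adelicGroupData (↥(maximalRealSubfield L)) L (IsCMField.complexConj L) N H).Adelic)⁻¹))) * φ₂ x) ∧
              doublingPairing (adelicGroupData (↥(maximalRealSubfield L)) L (IsCMField.complexConj L) N H) μ
                  (toQuotFun₂ (adelicGroupData (↥(maximalRealSubfield L)) L (IsCMField.complexConj L) N H)
                    (eisensteinPullback L e dV hdV dW hdW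
                      (adelicGroupData (↥(maximalRealSubfield L)) L (IsCMField.complexConj L) N H) ιA f)) φ₁ φ₂ =
                doublingZeta L e dV hdV dW hdW (adelicGroupData (↥(maximalRealSubfield L)) L (IsCMField.complexConj L) N H)
                  ν μ ιA f φ₁
                  (fun x => starRingEnd ℂ (siegelDeltaCharacter L e dV hdV dW hdW χ s
                      (iotaV L e dV hdV dW hdW
                        (ιA ((Quotient.out (x : (adelicGroupData (↥(maximalRealSubfield L)) L (IsCMField.complexConj L) N H).Adelic ⧸
                            (adelicGroupData (↥(maximalRealSubfield L)) L (IsCMField.complexConj L) N H).quotientSubgroup)) :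
                            (adelicGroupData (↥(maximalRealSubfield L)) L (IsCMField.complexConj L) N H).Adelic)⁻¹,
                         ιA ((Quotient.out (x : (adelicGroupData (↥(maximalRealSubfield L)) L (IsCMField.complexConj L) N H).Adelic ⧸
                            (adelicGroupData (↥(maximalRealSubfield L)) L (IsCMField.complexConj L) N H).quotientSubgroup)) :
                            (adelicGroupData (↥(maximalRealSubfield L)) L (IsCMField.complexConj L) N H).Adelic)⁻¹))) * φ₂ x) := by
  intro L _ _ _ N n e H dV hdV dW hdW hdV0 hdW0 t ht g hg _hanis hMain μ hμA ιA hιA _instC _instM _instB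
  -- ## instances on `G := U(H)(𝔸)` and `Γ := U(H)(L⁺)`
  haveI hT2 : T2Space (adelicGroupData (↥(maximalRealSubfield L)) L (IsCMField.complexConj L) N H).Adelic :=
    inferInstanceAs (T2Space (UnitaryGroup.adelic (↥(maximalRealSubfield L)) L (IsCMField.complexConj L) N H))
  haveI hLC : LocallyCompactSpace (adelicGroupData (↥(maximalRealSubfield L)) L (IsCMField.complexConj L) N H).Adelic :=
    inferInstanceAs (LocallyCompactSpace (UnitaryGroup.adelic (↥(maximalRealSubfield L)) L (IsCMField.complexConj L) N H))
  haveI hSC : SecondCountableTopology (adelicGroupData (↥(maximalRealSubfield L)) L (IsCMField.complexConj L) N H).Adelic :=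
    inferInstanceAs (SecondCountableTopology (UnitaryGroup.adelic (↥(maximalRealSubfield L)) L (IsCMField.complexConj L) N H))
  have hq : (adelicGroupData (↥(maximalRealSubfield L)) L (IsCMField.complexConj L) N H).quotientSubgroup =
      (adelicGroupData (↥(maximalRealSubfield L)) L (IsCMField.complexConj L) N H).arithmeticSubgroup := by
    rw [AdelicGroupData.quotientSubgroup, show (adelicGroupData (↥(maximalRealSubfield L)) L (IsCMField.complexConj L) N H).center' = ⊥
      from rfl, bot_sup_eq]
  haveI hdisc : DiscreteTopology (adelicGroupData (↥(maximalRealSubfield L)) L (IsCMField.complexConj L) N H).quotientSubgroup := by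
    rw [hq]
    exact UnitaryGroup.adelicGroupData_isDiscreteRational L N H
  letI : MeasurableSpace ((adelicGroupData (↥(maximalRealSubfield L)) L (IsCMField.complexConj L) N H).Adelic ⧸
      (adelicGroupData (↥(maximalRealSubfield L)) L (IsCMField.complexConj L) N H).quotientSubgroup) :=
    (adelicGroupData (↥(maximalRealSubfield L)) L (IsCMField.complexConj L) N H).instMeasurableSpaceAutomorphicQuotient
  haveI : BorelSpace ((adelicGroupData (↥(maximalRealSubfield L)) L (IsCMField.complexConj L) N H).Adelic ⧸
      (adelicGroupData (↥(maximalRealSubfield L)) L (IsCMField.complexConj L) N H).quotientSubgroup) :=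
    (adelicGroupData (↥(maximalRealSubfield L)) L (IsCMField.complexConj L) N H).instBorelSpaceAutomorphicQuotient
  haveI : CompactSpace ((adelicGroupData (↥(maximalRealSubfield L)) L (IsCMField.complexConj L) N H).Adelic ⧸
      (adelicGroupData (↥(maximalRealSubfield L)) L (IsCMField.complexConj L) N H).quotientSubgroup) := _instC
  -- a two-sided Haar measure on `G`
  set dh : Measure (adelicGroupData (↥(maximalRealSubfield L)) L (IsCMField.complexConj L) N H).Adelic := Measure.haar with hdh_def
  haveI : dh.IsMulRightInvariant :=
    LevelOrbit.isMulRightInvariant_of_compactSpace_quotient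
      (adelicGroupData (↥(maximalRealSubfield L)) L (IsCMField.complexConj L) N H).quotientSubgroup dh
  haveI : Nonempty (adelicGroupData (↥(maximalRealSubfield L)) L (IsCMField.complexConj L) N H).automorphicQuotient := ⟨QuotientGroup.mk 1⟩
  have hμ : μ ≠ 0 := by
    intro h0
    have h := hμA.toIsOpenPosMeasure.open_pos Set.univ isOpen_univ Set.univ_nonempty
    rw [h0] at h
    exact h rfl
  -- the automorphic-measure axioms, re-keyed on the coset-space form `G ⧸ Γ`
  haveI : IsFiniteMeasure (α := (adelicGroupData (↥(maximalRealSubfield L)) L (IsCMField.complexConj L) N H).Adelic ⧸ (adelicGroupData (↥(maximalRealSubfield L)) L (IsCMField.complexConj L) N H).quotientSubgroup) μ := hμA.toIsFiniteMeasure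
  haveI : SMulInvariantMeasure (adelicGroupData (↥(maximalRealSubfield L)) L (IsCMField.complexConj L) N H).Adelic ((adelicGroupData (↥(maximalRealSubfield L)) L (IsCMField.complexConj L) N H).Adelic ⧸ (adelicGroupData (↥(maximalRealSubfield L)) L (IsCMField.complexConj L) N H).quotientSubgroup) μ := hμA.toSMulInvariantMeasure
  -- ## the engine
  obtain ⟨ν, hν, -, hmain⟩ := exists_haar_unfold_orbitSum_prod_integral
    (adelicGroupData (↥(maximalRealSubfield L)) L (IsCMField.complexConj L) N H).quotientSubgroup μ dh hμ
  refine ⟨ν, hν, fun χ s f hf hfc hsumE φ₁ φ₂ hφ₁ hφ₂ hint => ?_⟩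
  -- ## the data fed to the engine
  -- the summand `c k = f(ι(ιA k, 1))`
  set c : (adelicGroupData (↥(maximalRealSubfield L)) L (IsCMField.complexConj L) N H).Adelic → ℂ := (fun k => f (iotaLeft L e dV hdV dW hdW (ιA k))) with hc_def
  have hιc : Continuous ιA := by
    obtain ⟨Φ, -, hΦ⟩ := exists_continuousMulEquiv_eq_iotaA L H dV t ht g hg ιA hιA
    have h : (ιA : _ → _) = Φ := funext fun x => (hΦ x).symm
    rw [h]
    exact Φ.continuous
  have hcc : Continuous c := hfc.comp ((continuous_iotaLeft L e dV hdV dW hdW).comp hιc)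
  -- the twisted second vector `φ₂^χ = T · φ₂`
  set F₂ : (adelicGroupData (↥(maximalRealSubfield L)) L (IsCMField.complexConj L) N H).automorphicQuotient → ℂ := (fun x => starRingEnd ℂ (siegelDeltaCharacter L e dV hdV dW hdW χ s
      (iotaV L e dV hdV dW hdW
        (ιA ((Quotient.out (x : (adelicGroupData (↥(maximalRealSubfield L)) L (IsCMField.complexConj L) N H).Adelic ⧸ (adelicGroupData (↥(maximalRealSubfield L)) L (IsCMField.complexConj L) N H).quotientSubgroup)) : (adelicGroupData (↥(maximalRealSubfield L)) L (IsCMField.complexConj L) N H).Adelic)⁻¹,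
         ιA ((Quotient.out (x : (adelicGroupData (↥(maximalRealSubfield L)) L (IsCMField.complexConj L) N H).Adelic ⧸ (adelicGroupData (↥(maximalRealSubfield L)) L (IsCMField.complexConj L) N H).quotientSubgroup)) : (adelicGroupData (↥(maximalRealSubfield L)) L (IsCMField.complexConj L) N H).Adelic)⁻¹))) * φ₂ x) with hF₂_def
  have hF₂c : Continuous F₂ := (continuous_twist L e H dV hdV hdV0 dW hdW hdW0 t ht g hg ιA hιA χ s).mul hφ₂
  -- the orbit-sum kernel and its absolute majorant, read at `Quotient.out` representatives
  set K : (adelicGroupData (↥(maximalRealSubfield L)) L (IsCMField.complexConj L) N H).automorphicQuotient × (adelicGroupData (↥(maximalRealSubfield L)) L (IsCMField.complexConj L) N H).automorphicQuotient → ℂ := (fun p =>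
    ∑' γ : (adelicGroupData (↥(maximalRealSubfield L)) L (IsCMField.complexConj L) N H).quotientSubgroup,
      c ((Quotient.out (p.2 : (adelicGroupData (↥(maximalRealSubfield L)) L (IsCMField.complexConj L) N H).Adelic ⧸ (adelicGroupData (↥(maximalRealSubfield L)) L (IsCMField.complexConj L) N H).quotientSubgroup) : (adelicGroupData (↥(maximalRealSubfield L)) L (IsCMField.complexConj L) N H).Adelic) * γ *
        ((Quotient.out (p.1 : (adelicGroupData (↥(maximalRealSubfield L)) L (IsCMField.complexConj L) N H).Adelic ⧸ (adelicGroupData (↥(maximalRealSubfield L)) L (IsCMField.complexConj L) N H).quotientSubgroup) : (adelicGroupData (↥(maximalRealSubfield L)) L (IsCMField.complexConj L) N H).Adelic)⁻¹))) with hK_def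
  set Kabs : (adelicGroupData (↥(maximalRealSubfield L)) L (IsCMField.complexConj L) N H).automorphicQuotient × (adelicGroupData (↥(maximalRealSubfield L)) L (IsCMField.complexConj L) N H).automorphicQuotient → ℝ := (fun p =>
    ∑' γ : (adelicGroupData (↥(maximalRealSubfield L)) L (IsCMField.complexConj L) N H).quotientSubgroup,
      ‖c ((Quotient.out (p.2 : (adelicGroupData (↥(maximalRealSubfield L)) L (IsCMField.complexConj L) N H).Adelic ⧸ (adelicGroupData (↥(maximalRealSubfield L)) L (IsCMField.complexConj L) N H).quotientSubgroup) : (adelicGroupData (↥(maximalRealSubfield L)) L (IsCMField.complexConj L) N H).Adelic) * γ *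
        ((Quotient.out (p.1 : (adelicGroupData (↥(maximalRealSubfield L)) L (IsCMField.complexConj L) N H).Adelic ⧸ (adelicGroupData (↥(maximalRealSubfield L)) L (IsCMField.complexConj L) N H).quotientSubgroup) : (adelicGroupData (↥(maximalRealSubfield L)) L (IsCMField.complexConj L) N H).Adelic)⁻¹))‖) with hKabs_def
  have hK : ∀ x₁ x₂ : (adelicGroupData (↥(maximalRealSubfield L)) L (IsCMField.complexConj L) N H).Adelic, K ((x₁ : (adelicGroupData (↥(maximalRealSubfield L)) L (IsCMField.complexConj L) N H).Adelic ⧸ (adelicGroupData (↥(maximalRealSubfield L)) L (IsCMField.complexConj L) N H).quotientSubgroup), (x₂ : (adelicGroupData (↥(maximalRealSubfield L)) L (IsCMField.complexConj L) N H).Adelic ⧸ (adelicGroupData (↥(maximalRealSubfield L)) L (IsCMField.complexConj L) N H).quotientSubgroup)) =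
      ∑' γ : (adelicGroupData (↥(maximalRealSubfield L)) L (IsCMField.complexConj L) N H).quotientSubgroup, c (x₂ * γ * x₁⁻¹) := fun x₁ x₂ =>
    tsum_orbit_out_eq (adelicGroupData (↥(maximalRealSubfield L)) L (IsCMField.complexConj L) N H).quotientSubgroup c x₁ x₂
  have hKabs : ∀ x₁ x₂ : (adelicGroupData (↥(maximalRealSubfield L)) L (IsCMField.complexConj L) N H).Adelic, Kabs ((x₁ : (adelicGroupData (↥(maximalRealSubfield L)) L (IsCMField.complexConj L) N H).Adelic ⧸ (adelicGroupData (↥(maximalRealSubfield L)) L (IsCMField.complexConj L) N H).quotientSubgroup), (x₂ : (adelicGroupData (↥(maximalRealSubfield L)) L (IsCMField.complexConj L) N H).Adelic ⧸ (adelicGroupData (↥(maximalRealSubfield L)) L (IsCMField.complexConj L) N H).quotientSubgroup)) =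
      ∑' γ : (adelicGroupData (↥(maximalRealSubfield L)) L (IsCMField.complexConj L) N H).quotientSubgroup, ‖c (x₂ * γ * x₁⁻¹)‖ := fun x₁ x₂ =>
    tsum_orbit_out_eq (adelicGroupData (↥(maximalRealSubfield L)) L (IsCMField.complexConj L) N H).quotientSubgroup (fun y => ‖c y‖) x₁ x₂
  -- blindness of `f` and `‖f‖` to left rational Siegel factors
  have hfb : ∀ (p : siegelDeltaRat L e dV hdV dW hdW) (x : HA L e dV hdV dW hdW),
      f (((p : ratH L e dV hdV dW hdW) : HA L e dV hdV dW hdW) * x) = f x := fun p x => apply_siegelDeltaRat_mul L e dV hdV dW hdW hf p x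
  have hfbn : ∀ (p : siegelDeltaRat L e dV hdV dW hdW) (x : HA L e dV hdV dW hdW),
      ‖f (((p : ratH L e dV hdV dW hdW) : HA L e dV hdV dW hdW) * x)‖ = ‖f x‖ := fun p x => (norm_apply_siegelDeltaRat_mul L e dV hdV dW hdW hf p x).1
  have hfbc : ∀ (p : siegelDeltaRat L e dV hdV dW hdW) (x : HA L e dV hdV dW hdW),
      (((‖f (((p : ratH L e dV hdV dW hdW) : HA L e dV hdV dW hdW) * x)‖ : ℝ) : ℂ)) = ((‖f x‖ : ℝ) : ℂ) :=
    fun p x => (norm_apply_siegelDeltaRat_mul L e dV hdV dW hdW hf p x).2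
  -- the unit `χ_s(ι(ιA k⁻¹, ιA k⁻¹))`
  have hχne : ∀ k : (adelicGroupData (↥(maximalRealSubfield L)) L (IsCMField.complexConj L) N H).Adelic, siegelDeltaCharacter L e dV hdV dW hdW χ s (iotaV L e dV hdV dW hdW (ιA k⁻¹, ιA k⁻¹)) ≠ 0 := fun k => by
    rw [siegelDeltaCharacter_iotaV_diag L e dV hdV hdV0 dW hdW hdW0 χ s]
    exact Units.ne_zero _
  -- ## (hsum) summability of the orbit sums, from the socket's summability of `E_{‖f‖}`
  have hsum : ∀ x₁ x₂ : (adelicGroupData (↥(maximalRealSubfield L)) L (IsCMField.complexConj L) N H).Adelic, Summable fun γ : (adelicGroupData (↥(maximalRealSubfield L)) L (IsCMField.complexConj L) N H).quotientSubgroup => ‖c (x₂ * γ * x₁⁻¹)‖ := by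
    intro x₁ x₂
    have hs := (summable_eisenstein_iff L e H dV hdV dW hdW t ht g hg ιA hιA hMain (fun y => ‖f y‖) hfbn
      (iotaV L e dV hdV dW hdW (ιA x₁⁻¹, ιA x₂⁻¹))).1 (hsumE _)
    have heq : (fun γ : (adelicGroupData (↥(maximalRealSubfield L)) L (IsCMField.complexConj L) N H).quotientSubgroup => ‖f (iotaLeft L e dV hdV dW hdW (ιA γ) * iotaV L e dV hdV dW hdW (ιA x₁⁻¹, ιA x₂⁻¹))‖) =
        fun γ : (adelicGroupData (↥(maximalRealSubfield L)) L (IsCMField.complexConj L) N H).quotientSubgroup =>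
          ‖siegelDeltaCharacter L e dV hdV dW hdW χ s (iotaV L e dV hdV dW hdW (ιA x₂⁻¹, ιA x₂⁻¹))‖ * ‖c (x₂ * (γ : (adelicGroupData (↥(maximalRealSubfield L)) L (IsCMField.complexConj L) N H).Adelic) * x₁⁻¹)‖ := by
      funext γ
      rw [apply_iotaLeft_mul_iotaV L e H dV hdV dW hdW ιA hf, norm_mul]
    rw [heq] at hs
    exact (summable_mul_left_iff (norm_ne_zero_iff.2 (hχne x₂))).1 hs
  -- ## the two Eisenstein series read along the orbit bijection (same representatives `out q₁`, `out q₂` throughout)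
  have hEf : ∀ p : (adelicGroupData (↥(maximalRealSubfield L)) L (IsCMField.complexConj L) N H).automorphicQuotient × (adelicGroupData (↥(maximalRealSubfield L)) L (IsCMField.complexConj L) N H).automorphicQuotient,
      toQuotFun₂ (adelicGroupData (↥(maximalRealSubfield L)) L (IsCMField.complexConj L) N H) (eisensteinPullback L e dV hdV dW hdW (adelicGroupData (↥(maximalRealSubfield L)) L (IsCMField.complexConj L) N H) ιA f) p =
        siegelDeltaCharacter L e dV hdV dW hdW χ s (iotaV L e dV hdV dW hdW
          (ιA ((Quotient.out (p.2 : (adelicGroupData (↥(maximalRealSubfield L)) L (IsCMField.complexConj L) N H).Adelic ⧸ (adelicGroupData (↥(maximalRealSubfield L)) L (IsCMField.complexConj L) N H).quotientSubgroup)) : (adelicGroupData (↥(maximalRealSubfield L)) L (IsCMField.complexConj L) N H).Adelic)⁻¹,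
           ιA ((Quotient.out (p.2 : (adelicGroupData (↥(maximalRealSubfield L)) L (IsCMField.complexConj L) N H).Adelic ⧸ (adelicGroupData (↥(maximalRealSubfield L)) L (IsCMField.complexConj L) N H).quotientSubgroup)) : (adelicGroupData (↥(maximalRealSubfield L)) L (IsCMField.complexConj L) N H).Adelic)⁻¹)) * K p := by
    intro p
    show eisensteinSeriesDelta L e dV hdV dW hdW f (iotaV L e dV hdV dW hdW
        (ιA ((Quotient.out (p.1 : (adelicGroupData (↥(maximalRealSubfield L)) L (IsCMField.complexConj L) N H).Adelic ⧸ (adelicGroupData (↥(maximalRealSubfield L)) L (IsCMField.complexConj L) N H).quotientSubgroup)) : (adelicGroupData (↥(maximalRealSubfield L)) L (IsCMField.complexConj L) N H).Adelic)⁻¹,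
         ιA ((Quotient.out (p.2 : (adelicGroupData (↥(maximalRealSubfield L)) L (IsCMField.complexConj L) N H).Adelic ⧸ (adelicGroupData (↥(maximalRealSubfield L)) L (IsCMField.complexConj L) N H).quotientSubgroup)) : (adelicGroupData (↥(maximalRealSubfield L)) L (IsCMField.complexConj L) N H).Adelic)⁻¹)) = _
    rw [eisensteinSeriesDelta_eq_tsum L e H dV hdV dW hdW t ht g hg ιA hιA hMain f hfb, hK_def]
    dsimp only
    rw [← tsum_mul_left]
    exact tsum_congr fun γ => apply_iotaLeft_mul_iotaV L e H dV hdV dW hdW ιA hf _ _ _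
  have hEn : ∀ p : (adelicGroupData (↥(maximalRealSubfield L)) L (IsCMField.complexConj L) N H).automorphicQuotient × (adelicGroupData (↥(maximalRealSubfield L)) L (IsCMField.complexConj L) N H).automorphicQuotient,
      toQuotFun₂ (adelicGroupData (↥(maximalRealSubfield L)) L (IsCMField.complexConj L) N H) (eisensteinPullback L e dV hdV dW hdW (adelicGroupData (↥(maximalRealSubfield L)) L (IsCMField.complexConj L) N H) ιA (fun h => ((‖f h‖ : ℝ) : ℂ))) p =
        ((‖siegelDeltaCharacter L e dV hdV dW hdW χ s (iotaV L e dV hdV dW hdW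
          (ιA ((Quotient.out (p.2 : (adelicGroupData (↥(maximalRealSubfield L)) L (IsCMField.complexConj L) N H).Adelic ⧸ (adelicGroupData (↥(maximalRealSubfield L)) L (IsCMField.complexConj L) N H).quotientSubgroup)) : (adelicGroupData (↥(maximalRealSubfield L)) L (IsCMField.complexConj L) N H).Adelic)⁻¹,
           ιA ((Quotient.out (p.2 : (adelicGroupData (↥(maximalRealSubfield L)) L (IsCMField.complexConj L) N H).Adelic ⧸ (adelicGroupData (↥(maximalRealSubfield L)) L (IsCMField.complexConj L) N H).quotientSubgroup)) : (adelicGroupData (↥(maximalRealSubfield L)) L (IsCMField.complexConj L) N H).Adelic)⁻¹))‖ : ℝ) : ℂ) * ((Kabs p : ℝ) : ℂ) := by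
    intro p
    show eisensteinSeriesDelta L e dV hdV dW hdW (fun h => ((‖f h‖ : ℝ) : ℂ)) (iotaV L e dV hdV dW hdW
        (ιA ((Quotient.out (p.1 : (adelicGroupData (↥(maximalRealSubfield L)) L (IsCMField.complexConj L) N H).Adelic ⧸ (adelicGroupData (↥(maximalRealSubfield L)) L (IsCMField.complexConj L) N H).quotientSubgroup)) : (adelicGroupData (↥(maximalRealSubfield L)) L (IsCMField.complexConj L) N H).Adelic)⁻¹,
         ιA ((Quotient.out (p.2 : (adelicGroupData (↥(maximalRealSubfield L)) L (IsCMField.complexConj L) N H).Adelic ⧸ (adelicGroupData (↥(maximalRealSubfield L)) L (IsCMField.complexConj L) N H).quotientSubgroup)) : (adelicGroupData (↥(maximalRealSubfield L)) L (IsCMField.complexConj L) N H).Adelic)⁻¹)) = _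
    rw [eisensteinSeriesDelta_eq_tsum L e H dV hdV dW hdW t ht g hg ιA hιA hMain _ hfbc, hKabs_def]
    dsimp only
    rw [Complex.ofReal_tsum, ← tsum_mul_left]
    refine tsum_congr fun γ => ?_
    rw [apply_iotaLeft_mul_iotaV L e H dV hdV dW hdW ιA hf, norm_mul, Complex.ofReal_mul]
  -- ## (hint') the engine's integrability hypothesis is the socket's
  have hKabs0 : ∀ p, 0 ≤ Kabs p := fun p => tsum_nonneg fun _ => norm_nonneg _
  have hint' : Integrable (fun p : (adelicGroupData (↥(maximalRealSubfield L)) L (IsCMField.complexConj L) N H).automorphicQuotient × (adelicGroupData (↥(maximalRealSubfield L)) L (IsCMField.complexConj L) N H).automorphicQuotient => Kabs p * ‖φ₁ p.1‖ * ‖F₂ p.2‖) (μ.prod μ) := by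
    refine hint.congr (Filter.Eventually.of_forall fun p => ?_)
    dsimp only
    rw [hEn p]
    rw [norm_mul, norm_mul, Complex.norm_real, Complex.norm_real, Real.norm_of_nonneg (norm_nonneg _), Real.norm_of_nonneg (hKabs0 p),
      RCLike.norm_conj]
    ring
  -- ## run the engine
  obtain ⟨h1, -, h3⟩ := hmain c hcc φ₁ F₂ hφ₁ hF₂c hsum K hK Kabs hKabs hint'
  refine ⟨?_, ?_⟩
  · -- `DoublingZetaConverges` is the engine's (i)
    show Integrable (fun g' => f (iotaLeft L e dV hdV dW hdW (ιA g')) * quotMatrixCoeff (adelicGroupData (↥(maximalRealSubfield L)) L (IsCMField.complexConj L) N H) μ φ₁ F₂ g') ν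
    exact h1
  · -- the identity: `E_f φ₁ conj φ₂ = K φ₁ conj(φ₂^χ)` pointwise, then the engine's (iii)
    show (∫ x, toQuotFun₂ (adelicGroupData (↥(maximalRealSubfield L)) L (IsCMField.complexConj L) N H) (eisensteinPullback L e dV hdV dW hdW (adelicGroupData (↥(maximalRealSubfield L)) L (IsCMField.complexConj L) N H) ιA f) x * φ₁ x.1 * starRingEnd ℂ (φ₂ x.2) ∂(μ.prod μ)) =
      ∫ g', f (iotaLeft L e dV hdV dW hdW (ιA g')) * quotMatrixCoeff (adelicGroupData (↥(maximalRealSubfield L)) L (IsCMField.complexConj L) N H) μ φ₁ F₂ g' ∂ν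
    have hpt : ∀ x : (adelicGroupData (↥(maximalRealSubfield L)) L (IsCMField.complexConj L) N H).automorphicQuotient × (adelicGroupData (↥(maximalRealSubfield L)) L (IsCMField.complexConj L) N H).automorphicQuotient,
        toQuotFun₂ (adelicGroupData (↥(maximalRealSubfield L)) L (IsCMField.complexConj L) N H) (eisensteinPullback L e dV hdV dW hdW (adelicGroupData (↥(maximalRealSubfield L)) L (IsCMField.complexConj L) N H) ιA f) x * φ₁ x.1 * starRingEnd ℂ (φ₂ x.2) =
          K x * φ₁ x.1 * starRingEnd ℂ (F₂ x.2) := by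
      intro x
      rw [hEf x]
      simp only [hF₂_def, map_mul, Complex.conj_conj]
      ring
    rw [integral_congr_ae (Filter.Eventually.of_forall hpt)]
    refine h3.trans ?_
    simp only [hc_def, quotMatrixCoeff]
    rfl

end Summit.HodgeConjecture.HodgeConjecture.Cruxes.HLiu418.K2LiuDoublingUnfoldOfMainOrbit
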